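import Summits.MatrixMultiplication.MatrixMultiplication.Theorems.SaturationLadderTwinEndpoint
import HarnessLib

/-!
# SaturationLadder — twin-class defect inequalities and the asymptotic core of the ceiling

Route `SaturationLadder` (sub-problem `MatrixMultiplication`), crux `SubexpSaturation`
(stmt-MatrixMultiplication-25909).  The STAGE-2 twin class `SaturationLadderTwinExact.omegaRect_one_tw_exact`
certifies `ω(1, t, r) ≤ 1 + r` at `t = j n₁/((j+1) n₃ + n₅)`, `r = ((j+1) n₂ + n₁ + n₄)/((j+1) n₃ + n₅)`
for counts `n₁ + n₄ + n₅ = 2 n₆`, `n₂ + n₃ = 2^{j+1} n₆` subject to the two marginal-entropy hypotheses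
`H(Z) ≤ H(X)`, `H(Z) ≤ H(Y)` with `Z = (2, B, 1) n₆ / d`, `X = (B n₆ − n₃ + n₄ + n₆, n₁ + n₃, n₅)/d`,
`Y = (n₃ + n₅ + n₆, B n₆ + n₁ − n₃, n₄)/d` (`B = 2^{j+1}`, `d = (B + 3) n₆`).  The cell's ceiling programme
(BC9: «every rung a theorem AND the ceiling a theorem») is to prove that NO member of this class
witnesses a base below the design limit `(3125/128)^{1/3}` reached in `SaturationLadderTwinEndpoint`,
i.e. `(1 − t)·log r ≥ c₂ − O(1/(j+1))` with `c₂ = (5 log(5/4) + 3 log 2)/3 = log((3125/128)^{1/3})`.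

This file is STAGE 1 of that programme plus its asymptotic core, all sorry-free and definition-free:

* §1  scalar lemmas: the tangent (convexity) inequality for `x log x` (`mul_log_tangent`), the scaling
  identity (`mul_log_mul`), and the unfolding of a comparison of two three-atom entropies with a common
  mass into a comparison of `Σ x log x` (`entropy3_le_iff`, via `negMulLog_div`);
* §2  the two DEFECT INEQUALITIES of the class (real atoms, homogeneous in `n₆`): `H(Z) ≤ H(Y)` forces
  `(n₃ + n₅ + n₆) log(…) + n₄ log n₄ − 2n₆ log(2n₆) − n₆ log n₆ ≤ (n₃ − n₁)(log(B n₆) + 1)` (`defectY`),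
  and `H(Z) ≤ H(X)` forces `(n₁ + n₃) log(…) + n₅ log n₅ − 2n₆ log(2n₆) − n₆ log n₆ ≤
  (n₃ − n₄ − n₆)(log(B n₆) + 1)` (`defectX`) — the big atom is linearised at `B n₆` by the tangent
  inequality, which is sharp to second order, so nothing is lost asymptotically; `classY_iff` /
  `classX_iff` rewrite the class's `shannonEntropy` hypotheses (real atoms) into the `Σ x log x` form;
* §3  the ASYMPTOTIC CORE (`core`): for `n₃, n₄, n₅ ≥ 0`, `n₁ + n₄ + n₅ = 2` and `n₃ + ε ≥ max(n₁, n₄ + 1)`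
  (`ε ≥ 0`; these are the `j → ∞` limits of `defectY`, `defectX` after normalising `n₆ = 1`),
  `c₂ · n₃ ≤ (n₃ + n₅ + 1) log(n₃ + n₅ + 1) + n₄ log n₄ − 2 log 2 + (n₁ + n₅) log 2 + ε`,
  with equality at `ε = 0` exactly at the design point `(n₁, n₃, n₄, n₅) = (3/2, 3/2, 1/2, 0)` (`core_sharp`).
  Proof: two tangents (at `5/2` and `1/2`) and an explicit Farkas certificate
  `λ₁ n₅ + λ₂ (n₃ − n₁) + λ₃ (n₃ − n₄ − 1)` with `λ₂ = 1 − log 2 − log(5/4)/3`, `λ₃ = log 2 − log(5/4)/3`,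
  `λ₁ = log(5/4) + log 2 + 1 − λ₂`, all positive.

Why this is the right core (cell record, gen 15): along any class member, `1 − t = ((j+1)(n₃ − n₁) + n₁ + n₅)
/((j+1) n₃ + n₅)` and `log r = (j+1) log 2 − log n₃ + O(1)`, so `(1−t) log r → [ (n₃ − n₁)(j+1) log 2 +
(n₁ + n₅) log 2 ] / n₃ ≥ [Ψ_Y + (n₁+n₅) log 2]/n₃` by `defectY` (`Ψ_Y` = its left side at `n₆ = 1`), and
`core` says the right side is `≥ c₂` on the limit region cut out by `defectY` (`n₃ ≥ n₁`) and `defectX`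
(`n₃ ≥ n₄ + 1`); the numerics (`gen15/phi_region.py`) confirm the minimum `c₂` is attained only at the
design point.  STAGE 2 (next generation) supplies the `O(1/(j+1))` bookkeeping: `t ≥ 1/2 ⇒ 1 − t ≥
c/(j+1)` (from `defectX`, `defectY` by a sign case on `Ψ_Y`) and `(1−t) log r ≥ c₂ − K/(j+1)`, whence no
in-class `Base(θ)` witness for `θ³ < 3125/128`.  No definitions, no named facts, no sorry.
-/

set_option linter.dupNamespace false
-- (single-conjunct summit: the namespace repeats `MatrixMultiplication`)

noncomputable section

namespace Summit.MatrixMultiplication.MatrixMultiplication.Theorems.SaturationLadderTwinDefect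

open Literature.Computability.AlgebraicComplexity
open Summit.MatrixMultiplication.MatrixMultiplication.Theorems.SaturationLadderTwinEndpoint
  (log_five_halves_eq)

/-! ### §1  Scalar lemmas -/

/-- Tangent (convexity) inequality for `x ↦ x log x` at `x₀ > 0`, valid for every `y ≥ 0`
(`0 · log 0 = 0`):  `x₀ log x₀ + (log x₀ + 1)(y − x₀) ≤ y log y`. [folklore] -/
theorem mul_log_tangent {x₀ y : ℝ} (hx₀ : 0 < x₀) (hy : 0 ≤ y) :
    x₀ * Real.log x₀ + (Real.log x₀ + 1) * (y - x₀) ≤ y * Real.log y := by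
  rcases hy.eq_or_lt with h | h
  · rw [← h]
    have e : x₀ * Real.log x₀ + (Real.log x₀ + 1) * (0 - x₀) = -x₀ := by ring
    rw [e, zero_mul]
    linarith
  · have h1 := Real.one_sub_inv_le_log_of_pos (div_pos h hx₀)
    rw [inv_div, Real.log_div h.ne' hx₀.ne'] at h1
    have h2 := mul_le_mul_of_nonneg_left h1 h.le
    have e : y * (1 - x₀ / y) = y - x₀ := by field_simp
    rw [e] at h2
    linear_combination h2

/-- Scaling: `(c y) log(c y) = c (y log y + y log c)` for `c > 0`, `y ≥ 0`. [folklore] -/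
theorem mul_log_mul {c y : ℝ} (hc : 0 < c) (hy : 0 ≤ y) :
    (c * y) * Real.log (c * y) = c * (y * Real.log y + y * Real.log c) := by
  rcases hy.eq_or_lt with h | h
  · rw [← h]; simp
  · rw [Real.log_mul hc.ne' h.ne']; ring

/-- `negMulLog (x/d) = (x log d − x log x)/d` (`d ≠ 0`; all sign conventions of `Real.log`). [folklore] -/
theorem negMulLog_div (x d : ℝ) (hd : d ≠ 0) :
    Real.negMulLog (x / d) = (x * Real.log d - x * Real.log x) / d := by
  rcases eq_or_ne x 0 with hx | hx
  · rw [hx]; simp [Real.negMulLog]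
  · simp only [Real.negMulLog, Real.log_div hx hd]
    field_simp
    ring

/-- **Entropy comparison, three atoms, common mass.**  For `x₁ + x₂ + x₃ = y₁ + y₂ + y₃ = d > 0`:
`H(x/d) ≤ H(y/d) ⟺ Σ yᵢ log yᵢ ≤ Σ xᵢ log xᵢ` (`H` = `shannonEntropy`, bits; `0 log 0 = 0`). [folklore] -/
theorem entropy3_le_iff {x₁ x₂ x₃ y₁ y₂ y₃ d : ℝ} (hd : 0 < d)
    (hx : x₁ + x₂ + x₃ = d) (hy : y₁ + y₂ + y₃ = d) :
    shannonEntropy ![x₁ / d, x₂ / d, x₃ / d] ≤ shannonEntropy ![y₁ / d, y₂ / d, y₃ / d] ↔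
      y₁ * Real.log y₁ + y₂ * Real.log y₂ + y₃ * Real.log y₃ ≤
        x₁ * Real.log x₁ + x₂ * Real.log x₂ + x₃ * Real.log x₃ := by
  rw [shannonEntropy_def, shannonEntropy_def,
    div_le_div_iff_of_pos_right (Real.log_pos one_lt_two)]
  simp only [Fin.sum_univ_three, Matrix.cons_val_zero, Matrix.cons_val_one, Matrix.cons_val_two,
    Matrix.head_cons, Matrix.tail_cons]
  rw [negMulLog_div x₁ d hd.ne', negMulLog_div x₂ d hd.ne', negMulLog_div x₃ d hd.ne',
    negMulLog_div y₁ d hd.ne', negMulLog_div y₂ d hd.ne', negMulLog_div y₃ d hd.ne',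
    ← add_div, ← add_div, ← add_div, ← add_div, div_le_div_iff_of_pos_right hd]
  have ex : x₁ * Real.log d + x₂ * Real.log d + x₃ * Real.log d =
      y₁ * Real.log d + y₂ * Real.log d + y₃ * Real.log d := by
    rw [← add_mul, ← add_mul, hx, ← add_mul, ← add_mul, hy]
  constructor <;> intro h <;> linarith

/-! ### §2  The defect inequalities of the twin class (real atoms, homogeneous in `n₆`) -/

/-- The class hypothesis `H(Z) ≤ H(Y)` with real atoms, unfolded:  `Z = (n₁+n₄+n₅, n₂+n₃, n₆)/N`,
`Y = (n₃+n₅+n₆, n₁+n₂, n₄)/N`, `N = n₁ + ⋯ + n₆ > 0`. [folklore] -/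
theorem classY_iff {n₁ n₂ n₃ n₄ n₅ n₆ : ℝ} (hN : 0 < n₁ + n₂ + n₃ + n₄ + n₅ + n₆) :
    shannonEntropy ![(n₁ + n₄ + n₅) / (n₁ + n₂ + n₃ + n₄ + n₅ + n₆),
        (n₂ + n₃) / (n₁ + n₂ + n₃ + n₄ + n₅ + n₆), n₆ / (n₁ + n₂ + n₃ + n₄ + n₅ + n₆)] ≤
      shannonEntropy ![(n₃ + n₅ + n₆) / (n₁ + n₂ + n₃ + n₄ + n₅ + n₆),
        (n₁ + n₂) / (n₁ + n₂ + n₃ + n₄ + n₅ + n₆), n₄ / (n₁ + n₂ + n₃ + n₄ + n₅ + n₆)] ↔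
      (n₃ + n₅ + n₆) * Real.log (n₃ + n₅ + n₆) + (n₁ + n₂) * Real.log (n₁ + n₂) +
          n₄ * Real.log n₄ ≤
        (n₁ + n₄ + n₅) * Real.log (n₁ + n₄ + n₅) + (n₂ + n₃) * Real.log (n₂ + n₃) +
          n₆ * Real.log n₆ :=
  entropy3_le_iff hN (by ring) (by ring)

/-- The class hypothesis `H(Z) ≤ H(X)` with real atoms, unfolded:  `X = (n₂+n₄+n₆, n₁+n₃, n₅)/N`.
[folklore] -/
theorem classX_iff {n₁ n₂ n₃ n₄ n₅ n₆ : ℝ} (hN : 0 < n₁ + n₂ + n₃ + n₄ + n₅ + n₆) :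
    shannonEntropy ![(n₁ + n₄ + n₅) / (n₁ + n₂ + n₃ + n₄ + n₅ + n₆),
        (n₂ + n₃) / (n₁ + n₂ + n₃ + n₄ + n₅ + n₆), n₆ / (n₁ + n₂ + n₃ + n₄ + n₅ + n₆)] ≤
      shannonEntropy ![(n₂ + n₄ + n₆) / (n₁ + n₂ + n₃ + n₄ + n₅ + n₆),
        (n₁ + n₃) / (n₁ + n₂ + n₃ + n₄ + n₅ + n₆), n₅ / (n₁ + n₂ + n₃ + n₄ + n₅ + n₆)] ↔
      (n₂ + n₄ + n₆) * Real.log (n₂ + n₄ + n₆) + (n₁ + n₃) * Real.log (n₁ + n₃) +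
          n₅ * Real.log n₅ ≤
        (n₁ + n₄ + n₅) * Real.log (n₁ + n₄ + n₅) + (n₂ + n₃) * Real.log (n₂ + n₃) +
          n₆ * Real.log n₆ :=
  entropy3_le_iff hN (by ring) (by ring)

/-- **Defect inequality `(Y*)`.**  In the class (`n₁ + n₄ + n₅ = 2n₆`, `n₂ + n₃ = B n₆`, so the middle
`Y`-atom is `b = B n₆ + n₁ − n₃ ≥ 0`), `H(Z) ≤ H(Y)` in `Σ x log x` form forces
`(n₃+n₅+n₆) log(n₃+n₅+n₆) + n₄ log n₄ − 2n₆ log(2n₆) − n₆ log n₆ ≤ (n₃ − n₁)(log(B n₆) + 1)`: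
the big atom is linearised at `B n₆` by `mul_log_tangent`.
[cite: CoppersmithWinograd1990, §8] [cite: AlmanDuanVassilevskaWilliamsXuXuZhou2025, §3.4] -/
theorem defectY {n₁ n₃ n₄ n₅ n₆ b B : ℝ} (hB : 0 < B) (hn₆ : 0 < n₆) (hb0 : 0 ≤ b)
    (hb : b = B * n₆ + n₁ - n₃)
    (hY : (n₃ + n₅ + n₆) * Real.log (n₃ + n₅ + n₆) + b * Real.log b + n₄ * Real.log n₄ ≤
      (2 * n₆) * Real.log (2 * n₆) + (B * n₆) * Real.log (B * n₆) + n₆ * Real.log n₆) :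
    (n₃ + n₅ + n₆) * Real.log (n₃ + n₅ + n₆) + n₄ * Real.log n₄
        - (2 * n₆) * Real.log (2 * n₆) - n₆ * Real.log n₆ ≤
      (n₃ - n₁) * (Real.log (B * n₆) + 1) := by
  have ht := mul_log_tangent (mul_pos hB hn₆) hb0
  rw [hb] at ht hY
  have e : B * n₆ + n₁ - n₃ - B * n₆ = n₁ - n₃ := by ring
  rw [e] at ht
  linarith

/-- **Defect inequality `(X*)`.**  In the class the first `X`-atom is `b = B n₆ − n₃ + n₄ + n₆ ≥ 0`, and
`H(Z) ≤ H(X)` in `Σ x log x` form forces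
`(n₁+n₃) log(n₁+n₃) + n₅ log n₅ − 2n₆ log(2n₆) − n₆ log n₆ ≤ (n₃ − n₄ − n₆)(log(B n₆) + 1)`.
[cite: CoppersmithWinograd1990, §8] [cite: AlmanDuanVassilevskaWilliamsXuXuZhou2025, §3.4] -/
theorem defectX {n₁ n₃ n₄ n₅ n₆ b B : ℝ} (hB : 0 < B) (hn₆ : 0 < n₆) (hb0 : 0 ≤ b)
    (hb : b = B * n₆ - n₃ + n₄ + n₆)
    (hX : b * Real.log b + (n₁ + n₃) * Real.log (n₁ + n₃) + n₅ * Real.log n₅ ≤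
      (2 * n₆) * Real.log (2 * n₆) + (B * n₆) * Real.log (B * n₆) + n₆ * Real.log n₆) :
    (n₁ + n₃) * Real.log (n₁ + n₃) + n₅ * Real.log n₅
        - (2 * n₆) * Real.log (2 * n₆) - n₆ * Real.log n₆ ≤
      (n₃ - n₄ - n₆) * (Real.log (B * n₆) + 1) := by
  have ht := mul_log_tangent (mul_pos hB hn₆) hb0
  rw [hb] at ht hX
  have e : B * n₆ - n₃ + n₄ + n₆ - B * n₆ = n₄ + n₆ - n₃ := by ring
  rw [e] at ht
  linarith

/-- `(Y*)` at the class hypotheses: from `n₁ + n₄ + n₅ = 2n₆`, `n₂ + n₃ = B n₆`, `n₁, n₂ ≥ 0` (real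
atoms) and the `shannonEntropy` inequality `H(Z) ≤ H(Y)` exactly as in `omegaRect_one_tw_exact`
(real atoms). [cite: AlmanDuanVassilevskaWilliamsXuXuZhou2025, §3.4] -/
theorem defectY_of_class {n₁ n₂ n₃ n₄ n₅ n₆ B : ℝ} (hB : 0 < B) (hn₆ : 0 < n₆)
    (h₁ : 0 ≤ n₁) (h₂ : 0 ≤ n₂) (hz₁ : n₁ + n₄ + n₅ = 2 * n₆) (hz₂ : n₂ + n₃ = B * n₆)
    (hY : shannonEntropy ![(n₁ + n₄ + n₅) / (n₁ + n₂ + n₃ + n₄ + n₅ + n₆),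
        (n₂ + n₃) / (n₁ + n₂ + n₃ + n₄ + n₅ + n₆), n₆ / (n₁ + n₂ + n₃ + n₄ + n₅ + n₆)] ≤
      shannonEntropy ![(n₃ + n₅ + n₆) / (n₁ + n₂ + n₃ + n₄ + n₅ + n₆),
        (n₁ + n₂) / (n₁ + n₂ + n₃ + n₄ + n₅ + n₆), n₄ / (n₁ + n₂ + n₃ + n₄ + n₅ + n₆)]) :
    (n₃ + n₅ + n₆) * Real.log (n₃ + n₅ + n₆) + n₄ * Real.log n₄
        - (2 * n₆) * Real.log (2 * n₆) - n₆ * Real.log n₆ ≤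
      (n₃ - n₁) * (Real.log (B * n₆) + 1) := by
  have hBn := mul_pos hB hn₆
  have hN : 0 < n₁ + n₂ + n₃ + n₄ + n₅ + n₆ := by linarith
  rw [classY_iff hN, hz₁, hz₂] at hY
  exact defectY hB hn₆ (by linarith : 0 ≤ n₁ + n₂) (by linarith [hz₂] : n₁ + n₂ = B * n₆ + n₁ - n₃) hY

/-- `(X*)` at the class hypotheses (real atoms), as `defectY_of_class`.
[cite: AlmanDuanVassilevskaWilliamsXuXuZhou2025, §3.4] -/
theorem defectX_of_class {n₁ n₂ n₃ n₄ n₅ n₆ B : ℝ} (hB : 0 < B) (hn₆ : 0 < n₆)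
    (h₂ : 0 ≤ n₂) (h₄ : 0 ≤ n₄) (hz₁ : n₁ + n₄ + n₅ = 2 * n₆) (hz₂ : n₂ + n₃ = B * n₆)
    (hX : shannonEntropy ![(n₁ + n₄ + n₅) / (n₁ + n₂ + n₃ + n₄ + n₅ + n₆),
        (n₂ + n₃) / (n₁ + n₂ + n₃ + n₄ + n₅ + n₆), n₆ / (n₁ + n₂ + n₃ + n₄ + n₅ + n₆)] ≤
      shannonEntropy ![(n₂ + n₄ + n₆) / (n₁ + n₂ + n₃ + n₄ + n₅ + n₆),
        (n₁ + n₃) / (n₁ + n₂ + n₃ + n₄ + n₅ + n₆), n₅ / (n₁ + n₂ + n₃ + n₄ + n₅ + n₆)]) :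
    (n₁ + n₃) * Real.log (n₁ + n₃) + n₅ * Real.log n₅
        - (2 * n₆) * Real.log (2 * n₆) - n₆ * Real.log n₆ ≤
      (n₃ - n₄ - n₆) * (Real.log (B * n₆) + 1) := by
  have hBn := mul_pos hB hn₆
  have hN : 0 < n₁ + n₂ + n₃ + n₄ + n₅ + n₆ := by linarith
  rw [classX_iff hN, hz₁, hz₂] at hX
  exact defectX hB hn₆ (by linarith : 0 ≤ n₂ + n₄ + n₆)
    (by linarith [hz₂] : n₂ + n₄ + n₆ = B * n₆ - n₃ + n₄ + n₆) hX

/-! ### §3  The asymptotic core inequality -/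

/-- `log(1/2) = − log 2`. [folklore] -/
theorem log_half_eq : Real.log (1 / 2) = -Real.log 2 := by
  rw [Real.log_div one_ne_zero two_ne_zero, Real.log_one, zero_sub]

/-- **Asymptotic core of the twin-class ceiling** (robust form).  For `n₃, n₄, n₅ ≥ 0`, `n₁` real with
`n₁ + n₄ + n₅ = 2`, `ε ≥ 0` and `n₃ + ε ≥ max(n₁, n₄ + 1)`:
`c₂ · n₃ ≤ (n₃+n₅+1) log(n₃+n₅+1) + n₄ log n₄ − 2 log 2 + (n₁+n₅) log 2 + ε`,
`c₂ = (5 log(5/4) + 3 log 2)/3 = log((3125/128)^{1/3})`.  Two tangents (`mul_log_tangent` at `5/2`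
and `1/2`) and the Farkas certificate `λ₁ n₅ + λ₂ (n₃ + ε − n₁) + λ₃ (n₃ + ε − n₄ − 1)`,
`λ₂ = 1 − log 2 − log(5/4)/3 > 0`, `λ₃ = log 2 − log(5/4)/3 > 0`, `λ₁ = log(5/4) + log 2 + 1 − λ₂ > 0`,
`λ₂ + λ₃ = 1 − (2/3) log(5/4) ≤ 1`.
[cite: CoppersmithWinograd1990, §8] [cite: AlmanDuanVassilevskaWilliamsXuXuZhou2025, §3.4] -/
theorem core {n₁ n₃ n₄ n₅ ε : ℝ} (h₃ : 0 ≤ n₃) (h₄ : 0 ≤ n₄) (h₅ : 0 ≤ n₅)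
    (hε : 0 ≤ ε) (hz : n₁ + n₄ + n₅ = 2) (hA : n₁ ≤ n₃ + ε) (hB : n₄ + 1 ≤ n₃ + ε) :
    (5 * Real.log (5 / 4) + 3 * Real.log 2) / 3 * n₃ ≤
      (n₃ + n₅ + 1) * Real.log (n₃ + n₅ + 1) + n₄ * Real.log n₄ - 2 * Real.log 2
        + (n₁ + n₅) * Real.log 2 + ε := by
  have t1 := mul_log_tangent (show (0 : ℝ) < 5 / 2 by norm_num) (show 0 ≤ n₃ + n₅ + 1 by linarith)
  have t2 := mul_log_tangent (show (0 : ℝ) < 1 / 2 by norm_num) h₄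
  rw [log_five_halves_eq] at t1
  rw [log_half_eq] at t2
  have hl2 := Real.log_two_lt_d9
  have hl2' := Real.log_two_gt_d9
  have hm0 : 0 ≤ Real.log (5 / 4) := Real.log_nonneg (by norm_num)
  have hm1 : Real.log (5 / 4) ≤ 1 / 4 := by
    have := Real.log_le_sub_one_of_pos (show (0 : ℝ) < 5 / 4 by norm_num); linarith
  have hl2m : 0 ≤ 1 - Real.log 2 - Real.log (5 / 4) / 3 := by linarith
  have hl3 : 0 ≤ Real.log 2 - Real.log (5 / 4) / 3 := by linarith
  have hl1 : 0 ≤ Real.log (5 / 4) + Real.log 2 + 1 - (1 - Real.log 2 - Real.log (5 / 4) / 3) := by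
    linarith
  nlinarith [mul_nonneg hl1 h₅, mul_nonneg hl2m (sub_nonneg.2 hA), mul_nonneg hl3 (sub_nonneg.2 hB),
    mul_nonneg hm0 hε]

/-- The core inequality is SHARP: equality at `ε = 0` and the design point
`(n₁, n₃, n₄, n₅) = (3/2, 3/2, 1/2, 0)` — so `c₂` is the exact constant of the asymptotic core, matching the
endpoint `Base((3125/128)^{1/3})` of `SaturationLadderTwinEndpoint`. [folklore] -/
theorem core_sharp :
    (5 * Real.log (5 / 4) + 3 * Real.log 2) / 3 * (3 / 2 : ℝ) =
      ((3 / 2 : ℝ) + 0 + 1) * Real.log ((3 / 2 : ℝ) + 0 + 1) + (1 / 2 : ℝ) * Real.log (1 / 2)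
        - 2 * Real.log 2 + ((3 / 2 : ℝ) + 0) * Real.log 2 := by
  rw [show ((3 / 2 : ℝ) + 0 + 1) = 5 / 2 by norm_num, log_five_halves_eq, log_half_eq]
  ring

/-- The core in the cell's `Φ`-form: on the limit region (`ε = 0`, `n₃ > 0`) the normalised limit of
`(1 − t) log r` is at least `c₂`:  `c₂ ≤ [Ψ_Y + (n₁+n₅) log 2]/n₃`. [folklore] -/
theorem core_div {n₁ n₃ n₄ n₅ : ℝ} (h₄ : 0 ≤ n₄) (h₅ : 0 ≤ n₅)
    (hz : n₁ + n₄ + n₅ = 2) (hA : n₁ ≤ n₃) (hB : n₄ + 1 ≤ n₃) :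
    (5 * Real.log (5 / 4) + 3 * Real.log 2) / 3 ≤
      ((n₃ + n₅ + 1) * Real.log (n₃ + n₅ + 1) + n₄ * Real.log n₄ - 2 * Real.log 2
        + (n₁ + n₅) * Real.log 2) / n₃ := by
  have hn₃ : 0 < n₃ := by linarith
  rw [le_div_iff₀ hn₃]
  have := core hn₃.le h₄ h₅ le_rfl hz (by linarith) (by linarith)
  linarith

end Summit.MatrixMultiplication.MatrixMultiplication.Theorems.SaturationLadderTwinDefect

end
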